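import Summits.Ventures.PercRepro.GenQHyperplaneRowsA

/-!
# PercRepro — the flat-lattice counting rows, part D: no `(n − 1)`-point hyperplane trace in a coloop-free set
(night-4, gen 11)

If a rank-`(q − 1)` flat `H` meets `G` in all points but `x`, then `G ∖ x ⊆ H` has rank `≤ q − 1 < q`, so `x` is a
coloop of `G`.  Hence for coloop-free `G`: `h_{n−1} = 0` (`hypTr_pred_eq_zero_of_mTr_eq_zero`) — the row (NEARH) of the
two-level profile LP (sheet §65 (b)).  Imports `GenQHyperplaneRowsA`.
-/
namespace PercRepro.Night4

open Finset ThmH SixFour GenQ PerFlat Star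

variable {α : Type*} [DecidableEq α] {M : Matroid α} [M.Finite]

/-- **(NEARH)** a coloop-free set of rank `q` has no rank-`(q − 1)` flat with `n − 1` points of `G`. -/
theorem hypTr_pred_eq_zero_of_mTr_eq_zero {G : Finset α} {q : ℕ} (hG : G ⊆ gr M)
    (hrG : M.eRk (G : Set α) = (q : ℕ∞)) (hq : 1 ≤ q) (hmG : mTr M G = 0) (hn : 1 ≤ G.card) :
    hypTr M G (q - 1) (G.card - 1) = 0 := by
  classical
  unfold hypTr flatsTr
  rw [Finset.card_eq_zero, Finset.filter_eq_empty_iff]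
  intro H hH ⟨hcard, _⟩
  have hH' := mem_flatsQ.1 hH
  -- the point of `G` outside `H`
  have hsd : (G \ H).card = 1 := by
    rw [card_sdiff_eq_card_sub_card_inter, hcard]
    omega
  obtain ⟨x, hx⟩ := Finset.card_eq_one.1 hsd
  have hxG : x ∈ G := (Finset.mem_sdiff.1 (hx ▸ Finset.mem_singleton_self x)).1
  have hxH : x ∉ H := (Finset.mem_sdiff.1 (hx ▸ Finset.mem_singleton_self x)).2
  -- `G ∖ x ⊆ H` has rank `≤ q − 1`, so `x` is a coloop of `G`
  have hsub : G.erase x ⊆ H := by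
    intro y hy
    rw [Finset.mem_erase] at hy
    by_contra hyH
    have : y ∈ G \ H := Finset.mem_sdiff.2 ⟨hy.2, hyH⟩
    rw [hx, Finset.mem_singleton] at this
    exact hy.1 this
  have hle : M.eRk ((G.erase x : Finset α) : Set α) ≤ ((q - 1 : ℕ) : ℕ∞) := by
    rw [← hH'.2.2]
    exact M.eRk_mono (Finset.coe_subset.2 hsub)
  have hcol : x ∈ coloopsOf M G := by
    rw [mem_coloopsOf_iff_eRk_erase_ne hG hrG hxG]
    intro heq
    rw [heq] at hle
    have h1 : q ≤ q - 1 := by exact_mod_cast hle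
    omega
  have : 0 < mTr M G := by
    unfold mTr
    exact Finset.card_pos.2 ⟨x, hcol⟩
  omega

end PercRepro.Night4
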